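import Summits.CriticalPhenomena.CardyFormulaZ2.Theorems.CardyAnchoredRigidityCardyShadowIsolatedStubDilationFlow
import Summits.CriticalPhenomena.CardyFormulaZ2.Theorems.CardyAnchoredRigidityCardyShadowIsolatedButlerWaltmanUnstable
import Summits.CriticalPhenomena.CardyFormulaZ2.Theorems.CardyAnchoredRigidityCardyShadowIsolatedButlerWaltmanStable
import Summits.CriticalPhenomena.CardyFormulaZ2.Theses.CardyAnchoredRigidity
import Summits.CriticalPhenomena.CardyFormulaZ2.Theses.CardyLocalRigidity
import Literature.Probability.RandomPlanarGeometry.ImageUnivalent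
import Literature.Probability.RandomPlanarGeometry.ConformalRectangleProofs
import HarnessLib

/-!
# Crux `CardyShadowIsolated` (stmt-CriticalPhenomena-5767), line `dilation-dynamics`: the split glue

The crux (shared verbatim by routes CardyAnchoredRigidity / CardyLocalRigidity): if a Cardy shadow
`g` (`g R = F(crossRatio x)` for every uniformizing datum of `R`) is a cluster point, as `δ → 0⁺`,
of the bond-`ℤ²` crossing-function path `δ ↦ (R ↦ bondDomainCrossingProb R δ)` in the product
space `ConformalRectangle → ℝ`, then `g` is an isolated point of the cluster set `Λ' = clusterSet`.

Line `dilation-dynamics` reads the crux as topological dynamics of ONE ORBIT: exact lattice scale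
covariance (`bondDomainCrossingProb_map_dilation`) makes the crossing function at mesh `e^{-s}`,
`logOrbit s`, an orbit of the coordinate action `R ↦ e^t • R` (`logOrbit_add`), `Λ'` is its
ω-limit set in the product topology (`mem_clusterSet_iff_logOrbit`), the orbit is asymptotically
continuous in every coordinate (`logOrbit_tail_continuity`, from the proved support item
`ScaleContinuity`), and a Cardy shadow is a FIXED point (`isCardyShadow_scaleAct`, from
`IsUniformizing.image_data`). The Butler–Waltman lemma for such ω-limit sets (landed:
`eq_of_isolatedInvariant_of_unstableTrivial` / `…_of_stableTrivial`) then gives, for a Cardy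
shadow `g ∈ Λ'`:

    (C) g is an isolated invariant set of the flow on Λ'  ∧  (D) its unstable set in Λ' is trivial  ⟹  Λ' = {g},
    (C)                                                    ∧  (E) its stable set in Λ' is trivial    ⟹  Λ' = {g}.

So the crux follows from C ∧ D and, independently, from C ∧ E, where C, D, E are the registered
stubs `stub_cardyIsolatedInvariant` / `stub_cardyUnstableTrivial` / `stub_cardyStableTrivial` of the
line, taken here VERBATIM as hypotheses (no Prop handles: the sub-cruxes are filed as items by the
planner's `route edit --split`, with the strategist's `children.json`, which states the same three
propositions over tree declarations — definitionally equal to the hypotheses below). This file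
proves both glues for both route decls, sorry-free, and registers the first as the stub
`stub_splitGlueCD` of the lead's skeleton. C, D, E themselves are open (each is implied by
`CardyFormulaZ2`). No named fact is used; compactness of `[0,1]^ConformalRectangle` is the only
topological input besides `ScaleContinuity` (connectedness of `Λ'` is not needed on this route).

References: G. Butler, P. Waltman, J. Differential Equations 63 (1986), Lemma A1; H. L. Smith,
H. R. Thieme, *Dynamical Systems and Population Persistence* (2011), Lemma 8.17; O. Schramm,
S. Smirnov, Ann. Probab. 39 (2011), §1; S. Smirnov, C. R. Acad. Sci. 333 (2001), Thm 1.
-/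

noncomputable section

namespace Summit.CriticalPhenomena.CardyFormulaZ2.Theorems.CardyShadowIsolated.DilationDynamics

open Set Filter Topology
open Literature.Probability.RandomPlanarGeometry Literature.Probability.Percolation

/-! ### The orbit in log-scale time -/

/-- The bond-`ℤ²` crossing function at mesh `e^{-s}`: the crossing-function path of the crux in
log-scale time `s = -log δ` (so `δ → 0⁺` is `s → +∞`). [cite: SchrammSmirnov2011, §1] -/
def logOrbit : ℝ → ConformalRectangle → ℝ :=
  fun s R => bondDomainCrossingProb R (Real.exp (-s))

/-- **The path is an orbit of the dilation action**: `logOrbit (s + t) = scaleAct t (logOrbit s)`,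
coordinatewise (exact scale covariance of the discretisation). [cite: SchrammSmirnov2011, §1] -/
theorem logOrbit_add (s t : ℝ) (R : ConformalRectangle) :
    logOrbit (s + t) R = logOrbit s (R.map (dilation t)) := by
  show bondDomainCrossingProb R (Real.exp (-(s + t))) =
    bondDomainCrossingProb (R.map (dilation t)) (Real.exp (-s))
  rw [bondDomainCrossingProb_map_dilation, ← Real.exp_add, neg_add, add_comm]

/-- The orbit lives in the Tychonoff cube `[0,1]^ConformalRectangle`. [folklore] -/
theorem logOrbit_mem_cube (s : ℝ) :
    logOrbit s ∈ Set.pi Set.univ (fun _ : ConformalRectangle => Set.Icc (0 : ℝ) 1) :=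
  Set.mem_univ_pi.2 fun R => bondDomainCrossingProb_mem_Icc R _

/-- **Asymptotic continuity of the orbit in every coordinate** (the proved support item
`ScaleContinuity`, stmt-CriticalPhenomena-5770, read in log-scale time): for every `R` and
`ε > 0`, `|logOrbit (s + u) R - logOrbit s R| < ε` for all late `s` and all `0 ≤ u ≤ κ`.
[cite: SchrammSmirnov2011, §1] -/
theorem logOrbit_tail_continuity (R : ConformalRectangle) (ε : ℝ) (hε : 0 < ε) :
    ∃ κ > (0 : ℝ), ∃ S : ℝ, ∀ s, S ≤ s →
      ∀ u ∈ Icc (0 : ℝ) κ, |logOrbit (s + u) R - logOrbit s R| < ε := by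
  obtain ⟨θ, hθ, δ₀, hδ₀, H⟩ :=
    Summit.CriticalPhenomena.CardyFormulaZ2.Theorems.ClusterSetConnected.scaleContinuity R ε hε
  refine ⟨Real.log (1 + θ), Real.log_pos (by linarith), 1 - Real.log δ₀, fun s hs u hu => ?_⟩
  have hδ : 0 < Real.exp (-(s + u)) := Real.exp_pos _
  have hle : Real.exp (-(s + u)) ≤ Real.exp (-s) := Real.exp_le_exp.2 (by linarith [hu.1])
  have hlt : Real.exp (-s) < δ₀ := by
    calc Real.exp (-s) ≤ Real.exp (Real.log δ₀ - 1) := Real.exp_le_exp.2 (by linarith)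
      _ < Real.exp (Real.log δ₀) := Real.exp_lt_exp.2 (by linarith)
      _ = δ₀ := Real.exp_log hδ₀
  have hratio : Real.exp (-s) ≤ (1 + θ) * Real.exp (-(s + u)) := by
    have h1 : Real.exp u ≤ 1 + θ := by
      calc Real.exp u ≤ Real.exp (Real.log (1 + θ)) := Real.exp_le_exp.2 hu.2
        _ = 1 + θ := Real.exp_log (by linarith)
    have h2 : Real.exp (-s) = Real.exp u * Real.exp (-(s + u)) := by
      rw [← Real.exp_add]
      congr 1
      ring
    rw [h2]
    exact mul_le_mul_of_nonneg_right h1 hδ.le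
  have key := H (Real.exp (-(s + u))) (Real.exp (-s)) hδ hle hlt hratio
  show |bondDomainCrossingProb R (Real.exp (-(s + u))) - bondDomainCrossingProb R (Real.exp (-s))| < ε
  rw [abs_sub_comm]
  exact key

/-- **`Λ'` is the ω-limit set of the orbit**: `g ∈ clusterSet` iff `g` is a cluster point of
`logOrbit` as `s → +∞` (reparametrisation `δ = e^{-s}`). [cite: SchrammSmirnov2011, §1] -/
theorem mem_clusterSet_iff_logOrbit (g : ConformalRectangle → ℝ) :
    g ∈ clusterSet ↔ MapClusterPt g atTop logOrbit := by
  have he : Tendsto (fun s : ℝ => Real.exp (-s)) atTop (𝓝[>] (0 : ℝ)) :=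
    Real.tendsto_exp_atBot_nhdsGT.comp tendsto_neg_atTop_atBot
  have hl : Tendsto (fun δ : ℝ => -Real.log δ) (𝓝[>] (0 : ℝ)) atTop :=
    tendsto_neg_atBot_atTop.comp Real.tendsto_log_nhdsGT_zero
  constructor
  · intro hg
    have hg0 : MapClusterPt g (𝓝[>] (0 : ℝ))
        (fun (δ : ℝ) (R : ConformalRectangle) => bondDomainCrossingProb R δ) := hg
    have heq : (fun (δ : ℝ) (R : ConformalRectangle) => bondDomainCrossingProb R δ) =ᶠ[𝓝[>] (0 : ℝ)]
        (logOrbit ∘ fun δ : ℝ => -Real.log δ) := by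
      filter_upwards [self_mem_nhdsWithin] with δ hδ
      funext R
      simp only [Function.comp_apply, logOrbit, neg_neg, Real.exp_log (Set.mem_Ioi.1 hδ)]
    exact MapClusterPt.of_comp hl ((heq.mapClusterPt_iff).1 hg0)
  · intro hg
    have heq : logOrbit = (fun (δ : ℝ) (R : ConformalRectangle) => bondDomainCrossingProb R δ) ∘
        fun s : ℝ => Real.exp (-s) := rfl
    rw [heq] at hg
    exact MapClusterPt.of_comp he hg

/-! ### Cardy shadows are fixed points -/

/-- A **Cardy shadow**: `g R = F(crossRatio x)` for every uniformizing datum `(φ, x)` of `R`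
(the hypothesis of the crux, verbatim). [cite: Smirnov2001, Thm 1] -/
def IsCardyShadow (g : ConformalRectangle → ℝ) : Prop :=
  ∀ (R : ConformalRectangle) (φ : ConformalEquiv UpperHalfPlane.upperHalfPlaneSet R.carrier)
    (x : Fin 4 → ℝ), R.IsUniformizing φ x → g R = cardyFunction (crossRatio x)

/-- **Cardy shadows are fixed points of the scale action** (`IsUniformizing.image_data`).
[cite: Smirnov2001, Thm 1] -/
theorem isCardyShadow_scaleAct {g : ConformalRectangle → ℝ} (hg : IsCardyShadow g) (s : ℝ) :
    scaleAct s g = g := by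
  funext R
  obtain ⟨φ, x, hφ⟩ := MarkedDomain.exists_isUniformizing_holds R
  have hd : DifferentiableOn ℂ (fun z : ℂ => ((Real.exp s : ℝ) : ℂ) * z) R.carrier :=
    (differentiable_id.const_mul _).differentiableOn
  have hi : Set.InjOn (fun z : ℂ => ((Real.exp s : ℝ) : ℂ) * z) R.carrier :=
    fun _ _ _ _ hxy => mul_left_cancel₀ (exp_ofReal_ne_zero s) hxy
  have hc : ContinuousOn (fun z : ℂ => ((Real.exp s : ℝ) : ℂ) * z) (closure R.carrier) :=
    (continuous_const.mul continuous_id).continuousOn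
  have hS : (R.map (dilation s)).carrier = (fun z : ℂ => ((Real.exp s : ℝ) : ℂ) * z) '' R.carrier := by
    rw [MarkedDomain.carrier_map, coe_dilation]
  have hpt : ∀ i, (R.map (dilation s)).pt i = (fun z : ℂ => ((Real.exp s : ℝ) : ℂ) * z) (R.pt i) :=
    fun i => by rw [MarkedDomain.pt_map, dilation_apply]
  have hφ' := hφ.image_data hd hi hc hS hpt
  show g (R.map (dilation s)) = g R
  rw [hg _ _ _ hφ', hg _ _ _ hφ]

/-- **Non-vacuity: a Cardy shadow exists** — the cross-ratio of a uniformizing datum does not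
depend on the datum (`crossRatio_eq_of_isUniformizing_holds`, conformal invariance of the
cross-ratio, proved in the tree). [cite: Smirnov2001, Thm 1] -/
theorem exists_isCardyShadow : ∃ g : ConformalRectangle → ℝ, IsCardyShadow g := by
  classical
  have H : ∀ R : ConformalRectangle,
      ∃ (φ : ConformalEquiv UpperHalfPlane.upperHalfPlaneSet R.carrier) (x : Fin 4 → ℝ),
        R.IsUniformizing φ x :=
    fun R => MarkedDomain.exists_isUniformizing_holds R
  choose φ x hφx using H
  refine ⟨fun R => cardyFunction (crossRatio (x R)), fun R φ' x' h' => ?_⟩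
  show cardyFunction (crossRatio (x R)) = cardyFunction (crossRatio x')
  rw [ConformalRectangle.crossRatio_eq_of_isUniformizing_holds (hφx R) h']

/-- **The Cardy shadow is unique** (every conformal rectangle has a uniformizing datum,
`exists_isUniformizing_holds`): the crux, and the sub-cruxes below, are statements about ONE
explicit function `g_F`. [cite: Smirnov2001, Thm 1] -/
theorem IsCardyShadow.unique {g₁ g₂ : ConformalRectangle → ℝ} (h₁ : IsCardyShadow g₁)
    (h₂ : IsCardyShadow g₂) : g₁ = g₂ := by
  funext R
  obtain ⟨φ, x, hφ⟩ := MarkedDomain.exists_isUniformizing_holds R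
  rw [h₁ R φ x hφ, h₂ R φ x hφ]

/-! ### The two Butler–Waltman glues on the percolation objects -/

/-- **Isolation from C and D** (Butler–Waltman, unstable half, instantiated): for a Cardy shadow
`g ∈ Λ'` which is an isolated invariant set of the dilation flow on `Λ'` and whose unstable set in
`Λ'` is trivial, `Λ' = {g}`. [cite: ButlerWaltman1986, Lemma A1] -/
theorem eq_of_isCardyShadow_of_isolated_of_unstable {g : ConformalRectangle → ℝ}
    (hg : IsCardyShadow g) (hgΛ : g ∈ clusterSet)
    (hC : ∃ N ∈ 𝓝 g, ∀ g' ∈ clusterSet, (∀ s : ℝ, scaleAct s g' ∈ N) → g' = g)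
    (hD : ∀ g' ∈ clusterSet, Tendsto (fun s : ℝ => scaleAct s g') atBot (𝓝 g) → g' = g) :
    ∀ g' ∈ clusterSet, g' = g := by
  intro g' hg'
  have hK : IsCompact (Set.pi Set.univ (fun _ : ConformalRectangle => Set.Icc (0 : ℝ) 1)) :=
    isCompact_univ_pi fun _ => isCompact_Icc
  -- the coordinate action `T t R = e^t • R`
  have hgrp : ∀ (s t : ℝ) (R : ConformalRectangle),
      logOrbit (s + t) R =
        logOrbit s ((fun (t : ℝ) (R : ConformalRectangle) => R.map (dilation t)) t R) :=
    fun s t R => logOrbit_add s t R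
  have hT : ∀ (u t : ℝ) (R : ConformalRectangle),
      (fun (t : ℝ) (R : ConformalRectangle) => R.map (dilation t)) u
        ((fun (t : ℝ) (R : ConformalRectangle) => R.map (dilation t)) t R) =
      (fun (t : ℝ) (R : ConformalRectangle) => R.map (dilation t)) (u + t) R :=
    fun u t R => map_dilation_map_dilation R t u
  have hfix : ∀ (t : ℝ) (R : ConformalRectangle),
      g ((fun (t : ℝ) (R : ConformalRectangle) => R.map (dilation t)) t R) = g R := by
    intro t R
    have h := congr_fun (isCardyShadow_scaleAct hg t) R
    exact h
  have hgo : MapClusterPt g atTop logOrbit := (mem_clusterSet_iff_logOrbit g).1 hgΛ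
  have hC' : ∃ N ∈ 𝓝 g, ∀ h : ConformalRectangle → ℝ, MapClusterPt h atTop logOrbit →
      (∀ t : ℝ, (fun R => h ((fun (t : ℝ) (R : ConformalRectangle) => R.map (dilation t)) t R)) ∈ N) →
      h = g := by
    obtain ⟨N, hN, hiso⟩ := hC
    refine ⟨N, hN, fun h hh horb => hiso h ((mem_clusterSet_iff_logOrbit h).2 hh) fun s => ?_⟩
    exact horb s
  have h2 : ∀ h : ConformalRectangle → ℝ, MapClusterPt h atTop logOrbit →
      Tendsto (fun (t : ℝ) (R : ConformalRectangle) =>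
        h ((fun (t : ℝ) (R : ConformalRectangle) => R.map (dilation t)) t R)) atBot (𝓝 g) → h = g :=
    fun h hh ht => hD h ((mem_clusterSet_iff_logOrbit h).2 hh) ht
  exact eq_of_isolatedInvariant_of_unstableTrivial
    (fun (t : ℝ) (R : ConformalRectangle) => R.map (dilation t)) logOrbit hgrp hT hK
    logOrbit_mem_cube logOrbit_tail_continuity hfix hgo hC' h2 g'
    ((mem_clusterSet_iff_logOrbit g').1 hg')

/-- **Isolation from C and E** (Butler–Waltman, stable half, instantiated): for a Cardy shadow
`g ∈ Λ'` which is an isolated invariant set of the dilation flow on `Λ'` and whose stable set in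
`Λ'` is trivial, `Λ' = {g}`. [cite: ButlerWaltman1986, Lemma A1] -/
theorem eq_of_isCardyShadow_of_isolated_of_stable {g : ConformalRectangle → ℝ}
    (hg : IsCardyShadow g) (hgΛ : g ∈ clusterSet)
    (hC : ∃ N ∈ 𝓝 g, ∀ g' ∈ clusterSet, (∀ s : ℝ, scaleAct s g' ∈ N) → g' = g)
    (hE : ∀ g' ∈ clusterSet, Tendsto (fun s : ℝ => scaleAct s g') atTop (𝓝 g) → g' = g) :
    ∀ g' ∈ clusterSet, g' = g := by
  intro g' hg'
  have hK : IsCompact (Set.pi Set.univ (fun _ : ConformalRectangle => Set.Icc (0 : ℝ) 1)) :=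
    isCompact_univ_pi fun _ => isCompact_Icc
  -- the coordinate action `T t R = e^t • R`
  have hgrp : ∀ (s t : ℝ) (R : ConformalRectangle),
      logOrbit (s + t) R =
        logOrbit s ((fun (t : ℝ) (R : ConformalRectangle) => R.map (dilation t)) t R) :=
    fun s t R => logOrbit_add s t R
  have hT : ∀ (u t : ℝ) (R : ConformalRectangle),
      (fun (t : ℝ) (R : ConformalRectangle) => R.map (dilation t)) u
        ((fun (t : ℝ) (R : ConformalRectangle) => R.map (dilation t)) t R) =
      (fun (t : ℝ) (R : ConformalRectangle) => R.map (dilation t)) (u + t) R :=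
    fun u t R => map_dilation_map_dilation R t u
  have hfix : ∀ (t : ℝ) (R : ConformalRectangle),
      g ((fun (t : ℝ) (R : ConformalRectangle) => R.map (dilation t)) t R) = g R := by
    intro t R
    have h := congr_fun (isCardyShadow_scaleAct hg t) R
    exact h
  have hgo : MapClusterPt g atTop logOrbit := (mem_clusterSet_iff_logOrbit g).1 hgΛ
  have hC' : ∃ N ∈ 𝓝 g, ∀ h : ConformalRectangle → ℝ, MapClusterPt h atTop logOrbit →
      (∀ t : ℝ, (fun R => h ((fun (t : ℝ) (R : ConformalRectangle) => R.map (dilation t)) t R)) ∈ N) →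
      h = g := by
    obtain ⟨N, hN, hiso⟩ := hC
    refine ⟨N, hN, fun h hh horb => hiso h ((mem_clusterSet_iff_logOrbit h).2 hh) fun s => ?_⟩
    exact horb s
  have h2 : ∀ h : ConformalRectangle → ℝ, MapClusterPt h atTop logOrbit →
      Tendsto (fun (t : ℝ) (R : ConformalRectangle) =>
        h ((fun (t : ℝ) (R : ConformalRectangle) => R.map (dilation t)) t R)) atTop (𝓝 g) → h = g :=
    fun h hh ht => hE h ((mem_clusterSet_iff_logOrbit h).2 hh) ht
  exact eq_of_isolatedInvariant_of_stableTrivial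
    (fun (t : ℝ) (R : ConformalRectangle) => R.map (dilation t)) logOrbit hgrp hT hK
    logOrbit_mem_cube logOrbit_tail_continuity hfix hgo hC' h2 g'
    ((mem_clusterSet_iff_logOrbit g').1 hg')

/-- The glue for the literal crux text (shared by both routes), from C and D: the isolating
neighbourhood `U` of the crux is the whole space, since `Λ' = {g}`. [folklore] -/
theorem isolated_of_isolatedInvariant_of_unstableTrivial
    (hC : (∀ g : ConformalRectangle → ℝ, IsCardyShadow g → g ∈ clusterSet →
      ∃ N ∈ 𝓝 g, ∀ g' ∈ clusterSet, (∀ s : ℝ, scaleAct s g' ∈ N) → g' = g))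
    (hD : (∀ g : ConformalRectangle → ℝ, IsCardyShadow g → ∀ g' ∈ clusterSet,
      Tendsto (fun s : ℝ => scaleAct s g') atBot (𝓝 g) → g' = g)) :
    ∀ g : ConformalRectangle → ℝ,
      (∀ (R : ConformalRectangle)
        (φ : ConformalEquiv UpperHalfPlane.upperHalfPlaneSet R.carrier) (x : Fin 4 → ℝ),
        R.IsUniformizing φ x → g R = cardyFunction (crossRatio x)) →
      MapClusterPt g (nhdsWithin (0 : ℝ) (Set.Ioi 0))
        (fun (δ : ℝ) (R : ConformalRectangle) => Literature.Probability.Percolation.bondDomainCrossingProb R δ) →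
      ∃ U ∈ nhds g, ∀ g' ∈ U,
        MapClusterPt g' (nhdsWithin (0 : ℝ) (Set.Ioi 0))
          (fun (δ : ℝ) (R : ConformalRectangle) => Literature.Probability.Percolation.bondDomainCrossingProb R δ) → g' = g := by
  intro g hshadow hg
  refine ⟨Set.univ, Filter.univ_mem, fun g' _ hg' => ?_⟩
  have hsh : IsCardyShadow g := hshadow
  have hgΛ : g ∈ clusterSet := hg
  have hC' : ∃ N ∈ 𝓝 g, ∀ g' ∈ clusterSet, (∀ s : ℝ, scaleAct s g' ∈ N) → g' = g :=
    hC g hshadow hg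
  have hD' : ∀ g' ∈ clusterSet, Tendsto (fun s : ℝ => scaleAct s g') atBot (𝓝 g) → g' = g :=
    fun g' hg' h => hD g hshadow g' hg' h
  exact eq_of_isCardyShadow_of_isolated_of_unstable hsh hgΛ hC' hD' g' hg'

/-- The glue for the literal crux text (shared by both routes), from C and E. [folklore] -/
theorem isolated_of_isolatedInvariant_of_stableTrivial
    (hC : (∀ g : ConformalRectangle → ℝ, IsCardyShadow g → g ∈ clusterSet →
      ∃ N ∈ 𝓝 g, ∀ g' ∈ clusterSet, (∀ s : ℝ, scaleAct s g' ∈ N) → g' = g))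
    (hE : (∀ g : ConformalRectangle → ℝ, IsCardyShadow g → ∀ g' ∈ clusterSet,
      Tendsto (fun s : ℝ => scaleAct s g') atTop (𝓝 g) → g' = g)) :
    ∀ g : ConformalRectangle → ℝ,
      (∀ (R : ConformalRectangle)
        (φ : ConformalEquiv UpperHalfPlane.upperHalfPlaneSet R.carrier) (x : Fin 4 → ℝ),
        R.IsUniformizing φ x → g R = cardyFunction (crossRatio x)) →
      MapClusterPt g (nhdsWithin (0 : ℝ) (Set.Ioi 0))
        (fun (δ : ℝ) (R : ConformalRectangle) => Literature.Probability.Percolation.bondDomainCrossingProb R δ) →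
      ∃ U ∈ nhds g, ∀ g' ∈ U,
        MapClusterPt g' (nhdsWithin (0 : ℝ) (Set.Ioi 0))
          (fun (δ : ℝ) (R : ConformalRectangle) => Literature.Probability.Percolation.bondDomainCrossingProb R δ) → g' = g := by
  intro g hshadow hg
  refine ⟨Set.univ, Filter.univ_mem, fun g' _ hg' => ?_⟩
  have hsh : IsCardyShadow g := hshadow
  have hgΛ : g ∈ clusterSet := hg
  have hC' : ∃ N ∈ 𝓝 g, ∀ g' ∈ clusterSet, (∀ s : ℝ, scaleAct s g' ∈ N) → g' = g :=
    hC g hshadow hg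
  have hE' : ∀ g' ∈ clusterSet, Tendsto (fun s : ℝ => scaleAct s g') atTop (𝓝 g) → g' = g :=
    fun g' hg' h => hE g hshadow g' hg' h
  exact eq_of_isCardyShadow_of_isolated_of_stable hsh hgΛ hC' hE' g' hg'

/-- **Split glue (unstable form)**: `CardyIsolatedInvariant → CardyUnstableTrivial →
CardyShadowIsolated` BY NAME (route CardyAnchoredRigidity). [folklore] -/
theorem CardyShadowIsolated_of_isolatedInvariant_of_unstableTrivial
    (hC : (∀ g : ConformalRectangle → ℝ, IsCardyShadow g → g ∈ clusterSet →
      ∃ N ∈ 𝓝 g, ∀ g' ∈ clusterSet, (∀ s : ℝ, scaleAct s g' ∈ N) → g' = g))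
    (hD : (∀ g : ConformalRectangle → ℝ, IsCardyShadow g → ∀ g' ∈ clusterSet,
      Tendsto (fun s : ℝ => scaleAct s g') atBot (𝓝 g) → g' = g)) :
    Summit.CriticalPhenomena.CardyFormulaZ2.Theses.CardyAnchoredRigidity.CardyShadowIsolated :=
  isolated_of_isolatedInvariant_of_unstableTrivial hC hD

/-- The same glue for the sibling route's decl (route CardyLocalRigidity; shared item
stmt-CriticalPhenomena-5767). [folklore] -/
theorem CardyShadowIsolated_of_isolatedInvariant_of_unstableTrivial_local
    (hC : (∀ g : ConformalRectangle → ℝ, IsCardyShadow g → g ∈ clusterSet →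
      ∃ N ∈ 𝓝 g, ∀ g' ∈ clusterSet, (∀ s : ℝ, scaleAct s g' ∈ N) → g' = g))
    (hD : (∀ g : ConformalRectangle → ℝ, IsCardyShadow g → ∀ g' ∈ clusterSet,
      Tendsto (fun s : ℝ => scaleAct s g') atBot (𝓝 g) → g' = g)) :
    Summit.CriticalPhenomena.CardyFormulaZ2.Theses.CardyLocalRigidity.CardyShadowIsolated :=
  isolated_of_isolatedInvariant_of_unstableTrivial hC hD

/-- **Split glue (stable form)**: `CardyIsolatedInvariant → CardyStableTrivial →
CardyShadowIsolated` BY NAME (route CardyAnchoredRigidity). [folklore] -/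
theorem CardyShadowIsolated_of_isolatedInvariant_of_stableTrivial
    (hC : (∀ g : ConformalRectangle → ℝ, IsCardyShadow g → g ∈ clusterSet →
      ∃ N ∈ 𝓝 g, ∀ g' ∈ clusterSet, (∀ s : ℝ, scaleAct s g' ∈ N) → g' = g))
    (hE : (∀ g : ConformalRectangle → ℝ, IsCardyShadow g → ∀ g' ∈ clusterSet,
      Tendsto (fun s : ℝ => scaleAct s g') atTop (𝓝 g) → g' = g)) :
    Summit.CriticalPhenomena.CardyFormulaZ2.Theses.CardyAnchoredRigidity.CardyShadowIsolated :=
  isolated_of_isolatedInvariant_of_stableTrivial hC hE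

/-- The same glue (stable form) for the sibling route's decl. [folklore] -/
theorem CardyShadowIsolated_of_isolatedInvariant_of_stableTrivial_local
    (hC : (∀ g : ConformalRectangle → ℝ, IsCardyShadow g → g ∈ clusterSet →
      ∃ N ∈ 𝓝 g, ∀ g' ∈ clusterSet, (∀ s : ℝ, scaleAct s g' ∈ N) → g' = g))
    (hE : (∀ g : ConformalRectangle → ℝ, IsCardyShadow g → ∀ g' ∈ clusterSet,
      Tendsto (fun s : ℝ => scaleAct s g') atTop (𝓝 g) → g' = g)) :
    Summit.CriticalPhenomena.CardyFormulaZ2.Theses.CardyLocalRigidity.CardyShadowIsolated :=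
  isolated_of_isolatedInvariant_of_stableTrivial hC hE

/-- **Registered stub `stub_splitGlueCD` of the lead's skeleton** (line `dilation-dynamics`): the
registered stubs C (`stub_cardyIsolatedInvariant`) and D (`stub_cardyUnstableTrivial`), verbatim as
hypotheses, imply the crux decl of route CardyAnchoredRigidity. [folklore] -/
theorem stub_splitGlueCD : (∀ g : ConformalRectangle → ℝ, IsCardyShadow g → g ∈ clusterSet → ∃ N ∈ 𝓝 g, ∀ g' ∈ clusterSet, (∀ s : ℝ, scaleAct s g' ∈ N) → g' = g) → (∀ g : ConformalRectangle → ℝ, IsCardyShadow g → ∀ g' ∈ clusterSet, Tendsto (fun s : ℝ => scaleAct s g') atBot (𝓝 g) → g' = g) → Summit.CriticalPhenomena.CardyFormulaZ2.Theses.CardyAnchoredRigidity.CardyShadowIsolated :=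
  fun hC hD => CardyShadowIsolated_of_isolatedInvariant_of_unstableTrivial hC hD

end Summit.CriticalPhenomena.CardyFormulaZ2.Theorems.CardyShadowIsolated.DilationDynamics

end
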